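import Literature.NumberTheory.Transcendental.LWMeasureMainProp
import Literature.NumberTheory.Transcendental.LWMeasureTheorem
import Literature.NumberTheory.Transcendental.QuantitativeCIAAffine
import HarnessLib

/-!
# Ably's measure of algebraic independence for `e^{y₁}, …, e^{yₙ}` — the named fact discharged

`Literature/NumberTheory/Transcendental/LindemannWeierstrassMeasureHolds.lean` — one theorem,
`Ably1994_lindemannWeierstrass_measure_holds`, discharging the named fact
`Literature.NumberTheory.Transcendental.Ably1994_lindemannWeierstrass_measure`
(`LindemannWeierstrassMeasure.lean`: M. Ably, *Une version quantitative du théorème de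
Lindemann–Weierstrass*, Acta Arith. 67 (1994) 29–45, Théorème p. 30, constants existential).

The proof is Ably's, run over `ℚ` with one extra letter for an integral generator of `ℚ(y)`:
§I the quantitative criterion (`QuantCIA.exists_const_affine_measure`, from the tree's
`QuantCIA.exists_const_polynomial_measure` — LNM 1752 Ch. 8 (CIA) in Nesterenko's normalisation);
§II the Proposition principale (`LWMeasure.Setup.mainProp`: Siegel's lemma, Diaz's modification,
Hermite extrapolation, Philippon's zero estimate on `𝔾ₐ × 𝔾ₘ`, Liouville — files
`LWMeasure{AlgebraicData, Construction, Analytic, Smallness, ZeroFree, ZeroFreeFinal,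
SmallnessComposite, SmallTermsEps, SmallTermMax, FamilySizes, MainPropArith, MainProp}.lean`);
§III the parameter choice (`LWMeasure.ably1994_of_criterion_of_mainProp`, `LWMeasureTheorem.lean`).

## References

* [Ably1994] M. Ably, *Une version quantitative du théorème de Lindemann–Weierstrass*, Acta Arith.
  67 (1994) 29–45.
* [NesterenkoPhilippon2001] Yu. V. Nesterenko, P. Philippon (eds.), LNM 1752 (2001), Ch. 3, Ch. 8.
-/

noncomputable section

namespace Literature.NumberTheory.Transcendental

/-- **Ably 1994, Théorème p. 30 — PROVED**: for `ℚ`-linearly independent algebraic `y₁, …, yₙ`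
there are `C, c₂ > 0` with `log |P(e^{y₁}, …, e^{yₙ})| ≥ −c₂ Dⁿ (log H + exp(C Dⁿ log(D+1)))`
for every non-zero `P ∈ ℤ[X₁, …, Xₙ]` of total degree `≤ D` and naive height `≤ H`. Discharges
the named fact `Ably1994_lindemannWeierstrass_measure`. [cite: Ably1994, Théorème p. 30] -/
theorem Ably1994_lindemannWeierstrass_measure_holds : Ably1994_lindemannWeierstrass_measure :=
  LWMeasure.ably1994_of_criterion_of_mainProp
    (fun _ _ hkm θ htr => QuantCIA.exists_const_affine_measure hkm θ htr)
    LWMeasure.Setup.mainProp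

end Literature.NumberTheory.Transcendental

end
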